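import Summits.KontsevichZagierPeriods.KontsevichZagierPeriods.Theorems.SoloBlindCycInverse
import Summits.KontsevichZagierPeriods.KontsevichZagierPeriods.Theorems.SoloBlindCycFlip
import Summits.KontsevichZagierPeriods.KontsevichZagierPeriods.Theorems.SoloBlindEta
import HarnessLib

/-!
# Euler's theorem inside the rules: every even zeta box lies in the `π`-sector

For every even `k = n + 2` the Beukers box `B_k = [(0,1)ᵏ, 1/(1 − x₁⋯x_k)]` (value `ζ(k)`)
satisfies, in the quotient `Q = FormalRep/relations` of the Kontsevich–Zagier calculus,

  **`(k!·(2ᵏ − 1)) · [B_k] = A_n · x_πᵏ`**,  `A_n = zigCount n` (`= 1, 4, 48, …`),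

by an explicit chain of moves, uniform in the dimension:
`2ᵏ[Λ'_k] = (2ᵏ−1)[B_k]` (`SoloBlindEta`) — `Λ'_k = [(0,1)ᵏ, 1/(1−P²)] ≡ [T_n, w]` (ONE move
along the cyclic tangent chart, `SoloBlindCycInverse`; for even `n` the Jacobian factor
`1 − (−1)ⁿP(Φ)²` cancels the integrand exactly) — `[T_n, w] ≡ [Zig_n, w] = A_n·[Δ_k, w]`
(`SoloBlindCycFlip`) — `k!·[Δ_k, w] = (2a(1))ᵏ`, `2·(2a(1)) = x_π` (`SoloBlindOrderCells`).

Consequences: `B_k ∈ M_π = K₀[x_π]` for every even `k` (`of_boxZetaRep_mem_piSector_even`), so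
the **Kontsevich–Zagier conjecture holds between `B_k` and every representation of the
`π`-sector with the same value** (`kz_boxZeta_even`), for all even `k` at once; and Euler's
`ζ(k) = A_n·πᵏ/(k!(2ᵏ−1))` is read off from the moves (`zetaValue_even`), e.g. `ζ(6) = π⁶/945`.
-/

noncomputable section

namespace Summit.KontsevichZagierPeriods.KontsevichZagierPeriods.Theorems

open Set MeasureTheory
open Literature.NumberTheory.Transcendental
open Literature.NumberTheory.Transcendental.KZ

namespace SoloBlind

variable {n : ℕ}

/-- **Rule (2) along the cyclic tangent chart, even dimension: `[T_n, w] ≡ Λ'_{n+2}`.** -/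
theorem cycPiece_equiv_evenBoxRep (hn : Even n) :
    Equivalent (cycPiece n) (evenBoxRep (n + 2) (by omega)) :=
  equivalent_of_cycChart (f := angWeight (n + 2)) (g := fun x => 1 / (1 - (∏ i, x i) ^ 2))
    (fun t ht => by
      have hP := (one_sub_prod_sq_pos (n := n + 2) (by omega) (cycChart_mem ht)).ne'
      rw [cycJac_eq, hn.neg_one_pow, one_mul, angWeight_eq]
      field_simp)
    rfl (fun t _ => by rw [cycPiece, angPiece_integrand]) rfl fun _ _ => rfl

/-- **`(n+2)!·[Λ'_{n+2}] = A_n·(2a(1))ⁿ⁺²` in `Q`** (`n` even). -/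
theorem factorial_nsmul_evenBoxRep (hn : Even n) :
    (n + 2).factorial • mkQ (of (evenBoxRep (n + 2) (by omega))) =
      zigCount n • ((2 : K₀) • alpha 1) ^ (n + 2) := by
  rw [← mkQ_eq_mkQ_iff.mpr (cycPiece_equiv_evenBoxRep hn), mkQ_cycPiece hn, smul_comm,
    factorial_nsmul_simplexPieceK]

/-- `x_π = 2·(2a(1))` in `Q`. -/
theorem xPi_eq_two_mul : xPi = 2 * ((2 : K₀) • alpha 1) := by
  rw [xPi, two_mul, ← add_smul]
  norm_num

/-- **Euler inside the rules: `((n+2)!(2ⁿ⁺² − 1))·[B_{n+2}] = A_n·x_πⁿ⁺²` in `Q`** (`n` even). -/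
theorem nsmul_mkQ_boxZeta_even (hn : Even n) :
    ((n + 2).factorial * (2 ^ (n + 2) - 1)) • mkQ (of (boxZetaRep (n + 2) (by omega))) =
      zigCount n • xPi ^ (n + 2) := by
  have h1 := factorial_nsmul_evenBoxRep hn
  have h2 := nsmul_mkQ_evenBox (n := n + 2) (by omega)
  rw [xPi_eq_two_mul]
  simp only [nsmul_eq_mul, Nat.cast_mul, Nat.cast_pow, Nat.cast_ofNat] at h1 h2 ⊢
  linear_combination (-((n + 2).factorial : Q)) * h2 + (2 : Q) ^ (n + 2) * h1

/-- **`B_{n+2} ∈ M_π`** (`n` even). -/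
theorem of_boxZetaRep_mem_piSector' (hn : Even n) :
    of (boxZetaRep (n + 2) (by omega)) ∈ piSector := by
  have h := nsmul_mkQ_boxZeta_even hn
  have ha : ((n + 2).factorial * (2 ^ (n + 2) - 1) : ℕ) ≠ 0 :=
    Nat.mul_ne_zero (Nat.factorial_ne_zero _) (Nat.sub_ne_zero_of_lt (Nat.one_lt_two_pow' _))
  have hz : mkQ (of (boxZetaRep (n + 2) (by omega))) =
      (((n + 2).factorial * (2 ^ (n + 2) - 1) : ℕ) : K₀)⁻¹ • (zigCount n • xPi ^ (n + 2)) := by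
    rw [← h, ← Nat.cast_smul_eq_nsmul K₀ ((n + 2).factorial * (2 ^ (n + 2) - 1)),
      inv_smul_smul₀ (Nat.cast_ne_zero.mpr ha)]
  rw [mem_piSector, hz]
  exact Subalgebra.smul_mem _ (Subalgebra.nsmul_mem _
    (Subalgebra.pow_mem _ (Algebra.self_mem_adjoin_singleton K₀ xPi) _) _) _

/-- **Every even zeta box `B_k` (`k ≥ 2` even) lies in the `π`-sector `M_π = K₀[x_π]`.** -/
theorem of_boxZetaRep_mem_piSector_even {k : ℕ} (hk : 2 ≤ k) (he : Even k) :
    of (boxZetaRep k hk) ∈ piSector := by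
  obtain ⟨n, rfl⟩ : ∃ n, k = n + 2 := ⟨k - 2, by omega⟩
  exact of_boxZetaRep_mem_piSector' ((Nat.even_add.mp he).mpr even_two)

/-- **The Kontsevich–Zagier conjecture for the even zeta boxes against the `π`-sector**: for
every even `k ≥ 2` and every representation `r'` (of any dimension) whose class lies in `M_π`
— products and powers of `B₂, B₄, B₆, …`, of `Λ'`, `A`, of the tangent and zig cells, rational
multiples of `x_π`-cells, … — `∫ B_k = ∫ r'` implies that `B_k` and `r'` are connected by the
three moves. -/
theorem kz_boxZeta_even {k m : ℕ} (hk : 2 ≤ k) (he : Even k) (r' : IntegralRep m)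
    (hr' : of r' ∈ piSector) (hv : (boxZetaRep k hk).value = r'.value) :
    Equivalent (boxZetaRep k hk) r' :=
  kz_piSector _ _ (of_boxZetaRep_mem_piSector_even hk he) hr' hv

/-- In particular any two products of even zeta boxes with equal value are KZ-equivalent, e.g.
`B_j × B_k` versus a rational multiple of `B_{j+k}`: here the basic instance `B_j` vs `B_k`-side
representation `r'` built from even boxes. -/
theorem kz_boxZeta_even_mul {j k m : ℕ} (hj : 2 ≤ j) (hej : Even j) (hk : 2 ≤ k) (hek : Even k)
    (r' : IntegralRep m) (hr' : of r' ∈ piSector)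
    (hv : ((boxZetaRep j hj).prod (boxZetaRep k hk)).value = r'.value) :
    Equivalent ((boxZetaRep j hj).prod (boxZetaRep k hk)) r' :=
  kz_piSector _ _ (by
    rw [← of_mul_of]
    exact piSector.mul_mem (of_boxZetaRep_mem_piSector_even hj hej)
      (of_boxZetaRep_mem_piSector_even hk hek)) hr' hv

/-! ## Euler's formula, read off from the moves -/

/-- **`∫ B_{n+2} = A_n·πⁿ⁺²/((n+2)!(2ⁿ⁺²−1))`** (`n` even), by evaluating the identity in `Q`. -/
theorem boxZetaRep_value_even (hn : Even n) :
    (boxZetaRep (n + 2) (by omega)).value =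
      zigCount n * Real.pi ^ (n + 2) / ((n + 2).factorial * (2 ^ (n + 2) - 1)) := by
  have h := congrArg evalQ (nsmul_mkQ_boxZeta_even hn)
  rw [map_nsmul, map_nsmul, map_pow, evalQ_xPi, evalQ_mkQ, eval_of, nsmul_eq_mul, nsmul_eq_mul,
    Nat.cast_mul, Nat.cast_sub Nat.one_le_two_pow, Nat.cast_pow] at h
  have h2 : (1 : ℝ) < 2 ^ (n + 2) := one_lt_pow₀ (by norm_num) (by omega)
  have hN : (0 : ℝ) < (n + 2).factorial * (2 ^ (n + 2) - 1) :=
    mul_pos (Nat.cast_pos.mpr (Nat.factorial_pos _)) (by linarith)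
  rw [eq_div_iff hN.ne']
  push_cast at h
  linarith

/-- **Euler's theorem `ζ(n+2) = A_n·πⁿ⁺²/((n+2)!(2ⁿ⁺²−1))` for even `n`**, with the rational
coefficient as a count of zig permutations (`∫ B_k = ζ(k)` is `boxZetaRep_value`). -/
theorem zetaValue_even (hn : Even n) :
    zetaValue (n + 2) =
      zigCount n * Real.pi ^ (n + 2) / ((n + 2).factorial * (2 ^ (n + 2) - 1)) := by
  rw [← boxZetaRep_value (n := n + 2) (by omega), boxZetaRep_value_even hn]

/-- `ζ(6) = π⁶/945` (`A_4 = 48`), inside the rules. -/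
theorem zetaValue_six : zetaValue 6 = Real.pi ^ 6 / 945 := by
  rw [zetaValue_even (n := 4) (by decide), zigCount_four]
  norm_num [Nat.factorial]
  ring

/-- **`[B₆] = (1/945)·x_π⁶` in `Q`.** -/
theorem mkQ_boxSix : mkQ (of (boxZetaRep 6 (by norm_num))) = (945 : K₀)⁻¹ • xPi ^ 6 := by
  have h := nsmul_mkQ_boxZeta_even (n := 4) (by decide)
  rw [zigCount_four, ← Nat.cast_smul_eq_nsmul K₀, ← Nat.cast_smul_eq_nsmul K₀ 48] at h
  norm_num [Nat.factorial] at h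
  rw [← inv_smul_smul₀ (by norm_num : (45360 : K₀) ≠ 0) (mkQ (of (boxZetaRep 6 _))), h,
    smul_smul]
  norm_num

/-- **`945·[B₆] = x_π⁶` in `Q`.** -/
theorem nsmul_mkQ_boxSix : 945 • mkQ (of (boxZetaRep 6 (by norm_num))) = xPi ^ 6 := by
  rw [mkQ_boxSix, ← Nat.cast_smul_eq_nsmul K₀, smul_smul]
  norm_num

end SoloBlind

end Summit.KontsevichZagierPeriods.KontsevichZagierPeriods.Theorems
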